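import Mathlib
import Literature.Analysis.FluidPDE.VectorCalculus
import Literature.Analysis.FluidPDE.VorticityCalculus
import HarnessLib

/-!
# Crux `PoloidalLiouville` (stmt-NavierStokesRegularity-1222, W1), crux idea «silent-shells» (ns-idea-15 g8):
# §2 the GLUING LEVER — disjointly supported steady Euler flows superpose (by name)

The silent-shells card's construction side (sketch `Cruxes/PoloidalLiouville/SilentShellsSketch.lean` v1.4 §2,
l.150–252), Theorems-side BY NAME with the sketch-local predicates `IsSteadyEulerC1`, `IsUnthreadedAbout`,
`HasCoplanarVorticity`, `MultiAxisCompacton` δ-unfolded into tree vocabulary: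

* `SilentShells.isSteadyEulerC1_add` — two `C¹` steady Euler pairs with DISJOINT supports of the velocities superpose:
  off `tsupport U₂` the sum is locally `U₁` and `∇P₂ = −(U₂·∇)U₂ = 0` there (and symmetrically);
* `SilentShells.isUnthreadedAbout_add` — unthreadedness about a common centre is additive;
* `SilentShells.multiAxisCompacton_of_blocks` — the attempted counterexample, kernel-checked MODULO ITS BLOCKS: two
  compactly supported `C¹` steady Euler flows with disjoint supports, both unthreaded about `0`, with three vorticity
  samples of trivial common orthogonal complement, give a `MultiAxisCompacton` (compactly supported steady Euler flow,
  unthreaded about a point, vorticity NOT coplanar).  By `SilentShells.not_silentNoSwirlBlock`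
  (`ThreadingFluxSilentShellsJiuXinLiouville`, Jiu–Xin compact Liouville, now unconditional) axisymmetric no-swirl blocks
  do not exist, so the lever has nothing to glue: this file records the lever, not a construction.

Information-grade structure (the card's §2); `--supports stmt-NavierStokesRegularity-1222 --as helper`; W1 movement 0;
NS regularity is NOT proved by any of this.
-/

-- the summit and its single problem share the name (D-0017 nested layout)
set_option linter.dupNamespace false

noncomputable section

namespace Summit.NavierStokesRegularity.NavierStokesRegularity.Theorems.PoloidalLiouville.SilentShells

open Set Function Filter Topology
open scoped Topology RealInnerProductSpace
open Literature.Analysis.FluidPDE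

namespace Gluing

/-- Off `tsupport U₂`, `U₁ + U₂` agrees with `U₁` near the point. -/
theorem add_eventuallyEq_left {U₁ U₂ : EuclideanSpace ℝ (Fin 3) → EuclideanSpace ℝ (Fin 3)}
    {x : EuclideanSpace ℝ (Fin 3)} (hx : x ∉ tsupport U₂) : (U₁ + U₂) =ᶠ[𝓝 x] U₁ := by
  filter_upwards [notMem_tsupport_iff_eventuallyEq.mp hx] with y hy
  simp [hy]

/-- Off `tsupport U₁`, `U₁ + U₂` agrees with `U₂` near the point. -/
theorem add_eventuallyEq_right {U₁ U₂ : EuclideanSpace ℝ (Fin 3) → EuclideanSpace ℝ (Fin 3)}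
    {x : EuclideanSpace ℝ (Fin 3)} (hx : x ∉ tsupport U₁) : (U₁ + U₂) =ᶠ[𝓝 x] U₂ := by
  filter_upwards [notMem_tsupport_iff_eventuallyEq.mp hx] with y hy
  simp [hy]

/-- The sum of two `C¹` divergence-free fields is divergence free. -/
theorem isDivFree_add {U₁ U₂ : EuclideanSpace ℝ (Fin 3) → EuclideanSpace ℝ (Fin 3)} (hU₁ : ContDiff ℝ 1 U₁)
    (hU₂ : ContDiff ℝ 1 U₂) (h₁ : VectorCalculus.IsDivFree U₁) (h₂ : VectorCalculus.IsDivFree U₂) :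
    VectorCalculus.IsDivFree (U₁ + U₂) := by
  intro x
  have hd1 : DifferentiableAt ℝ U₁ x := (hU₁.differentiable one_ne_zero) x
  have hd2 : DifferentiableAt ℝ U₂ x := (hU₂.differentiable one_ne_zero) x
  have e1 := h₁ x
  have e2 := h₂ x
  unfold VectorCalculus.divergence at e1 e2 ⊢
  rw [fderiv_add hd1 hd2, ContinuousLinearMap.toLinearMap_add, map_add, e1, e2, add_zero]

/-- Off `tsupport U₂` the momentum equation of the sum is that of `U₁` (`∇P₂ = −(U₂·∇)U₂ = 0` there). -/
theorem steadyEuler_add_aux {U₁ U₂ : EuclideanSpace ℝ (Fin 3) → EuclideanSpace ℝ (Fin 3)}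
    {P₁ P₂ : EuclideanSpace ℝ (Fin 3) → ℝ} (hP₁ : ContDiff ℝ 1 P₁) (hP₂ : ContDiff ℝ 1 P₂)
    (hE₁ : ∀ x, convect U₁ U₁ x + gradient P₁ x = 0) (hE₂ : ∀ x, convect U₂ U₂ x + gradient P₂ x = 0)
    {x : EuclideanSpace ℝ (Fin 3)} (hx : x ∉ tsupport U₂) :
    convect (U₁ + U₂) (U₁ + U₂) x + gradient (P₁ + P₂) x = 0 := by
  have hx0 : U₂ x = 0 := image_eq_zero_of_notMem_tsupport hx
  have hP2 : gradient P₂ x = 0 := by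
    have := hE₂ x
    simpa [convect, hx0] using this
  have hd1 : DifferentiableAt ℝ P₁ x := (hP₁.differentiable one_ne_zero) x
  have hd2 : DifferentiableAt ℝ P₂ x := (hP₂.differentiable one_ne_zero) x
  have hgrad : gradient (P₁ + P₂) x = gradient P₁ x + gradient P₂ x := by
    unfold gradient
    rw [fderiv_add hd1 hd2, map_add]
  rw [convect_apply, (add_eventuallyEq_left hx).fderiv_eq, hgrad, hP2, add_zero, Pi.add_apply, hx0, add_zero]
  simpa [convect] using hE₁ x

end Gluing

open Gluing in
/-- **The gluing lever `isSteadyEulerC1_add`** (sketch §2 l.202, by name; `IsSteadyEulerC1` δ-unfolded): two `C¹` steady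
Euler pairs `(U₁,P₁)`, `(U₂,P₂)` on `ℝ³` — `Uᵢ, Pᵢ ∈ C¹`, `div Uᵢ = 0`, `(Uᵢ·∇)Uᵢ + ∇Pᵢ = 0` — whose velocity supports are
DISJOINT superpose: `(U₁ + U₂, P₁ + P₂)` is again a `C¹` steady Euler pair. -/
theorem isSteadyEulerC1_add
    {U₁ U₂ : EuclideanSpace ℝ (Fin 3) → EuclideanSpace ℝ (Fin 3)} {P₁ P₂ : EuclideanSpace ℝ (Fin 3) → ℝ}
    (h₁ : ContDiff ℝ 1 U₁ ∧ ContDiff ℝ 1 P₁ ∧ VectorCalculus.IsDivFree U₁ ∧ ∀ x, convect U₁ U₁ x + gradient P₁ x = 0)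
    (h₂ : ContDiff ℝ 1 U₂ ∧ ContDiff ℝ 1 P₂ ∧ VectorCalculus.IsDivFree U₂ ∧ ∀ x, convect U₂ U₂ x + gradient P₂ x = 0)
    (hdisj : Disjoint (tsupport U₁) (tsupport U₂)) :
    ContDiff ℝ 1 (U₁ + U₂) ∧ ContDiff ℝ 1 (P₁ + P₂) ∧ VectorCalculus.IsDivFree (U₁ + U₂) ∧
      ∀ x, convect (U₁ + U₂) (U₁ + U₂) x + gradient (P₁ + P₂) x = 0 := by
  refine ⟨h₁.1.add h₂.1, h₁.2.1.add h₂.2.1, isDivFree_add h₁.1 h₂.1 h₁.2.2.1 h₂.2.2.1, fun x => ?_⟩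
  by_cases hx : x ∈ tsupport U₂
  · have hx' : x ∉ tsupport U₁ := fun h => Set.disjoint_left.mp hdisj h hx
    have := steadyEuler_add_aux h₂.2.1 h₁.2.1 h₂.2.2.2 h₁.2.2.2 hx'
    rwa [add_comm U₂ U₁, add_comm P₂ P₁] at this
  · exact steadyEuler_add_aux h₁.2.1 h₂.2.1 h₁.2.2.2 h₂.2.2.2 hx

/-- **`isUnthreadedAbout_add`** (sketch §2 l.215, by name; `IsUnthreadedAbout x₀` δ-unfolded): unthreadedness about a common
centre `x₀` — vorticity tangent to every sphere about `x₀` — is additive on `C¹` fields. -/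
theorem isUnthreadedAbout_add {U₁ U₂ : EuclideanSpace ℝ (Fin 3) → EuclideanSpace ℝ (Fin 3)}
    {x₀ : EuclideanSpace ℝ (Fin 3)} (hU₁ : ContDiff ℝ 1 U₁) (hU₂ : ContDiff ℝ 1 U₂)
    (h₁ : ∀ x, ⟪x - x₀, curl U₁ x⟫ = 0) (h₂ : ∀ x, ⟪x - x₀, curl U₂ x⟫ = 0) :
    ∀ x, ⟪x - x₀, curl (U₁ + U₂) x⟫ = 0 := by
  intro x
  have hc : curl (U₁ + U₂) x = curl U₁ x + curl U₂ x := by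
    have := curl_add ((hU₁.differentiable one_ne_zero) x) ((hU₂.differentiable one_ne_zero) x)
    simpa [Pi.add_def] using this
  rw [hc, inner_add_right, h₁ x, h₂ x, add_zero]

open Gluing in
/-- **`multiAxisCompacton_of_blocks`** (sketch §2 l.236, by name; `IsSteadyEulerC1`, `IsUnthreadedAbout 0`,
`HasCoplanarVorticity`, `MultiAxisCompacton` δ-unfolded) — THE CONSTRUCTION, KERNEL-CHECKED MODULO ITS BLOCKS: two
compactly supported `C¹` steady Euler flows with disjoint supports, both unthreaded about `0`, with three vorticity samples
(two of block 1 off block 2, one of block 2 off block 1) of trivial common orthogonal complement, give a MULTI-AXIS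
COMPACTON: a compactly supported `C¹` steady Euler flow, unthreaded about a point, whose vorticity is not coplanar.  With
silent axisymmetric no-swirl blocks about two distinct axes the sample condition would be automatic — but such blocks do
not exist (`SilentShells.not_silentNoSwirlBlock`). -/
theorem multiAxisCompacton_of_blocks
    {U₁ U₂ : EuclideanSpace ℝ (Fin 3) → EuclideanSpace ℝ (Fin 3)} {P₁ P₂ : EuclideanSpace ℝ (Fin 3) → ℝ}
    {x₁ x₂ x₃ : EuclideanSpace ℝ (Fin 3)}
    (h₁ : ContDiff ℝ 1 U₁ ∧ ContDiff ℝ 1 P₁ ∧ VectorCalculus.IsDivFree U₁ ∧ ∀ x, convect U₁ U₁ x + gradient P₁ x = 0)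
    (h₂ : ContDiff ℝ 1 U₂ ∧ ContDiff ℝ 1 P₂ ∧ VectorCalculus.IsDivFree U₂ ∧ ∀ x, convect U₂ U₂ x + gradient P₂ x = 0)
    (hc₁ : HasCompactSupport U₁) (hc₂ : HasCompactSupport U₂) (hdisj : Disjoint (tsupport U₁) (tsupport U₂))
    (hu₁ : ∀ x, ⟪x - 0, curl U₁ x⟫ = 0) (hu₂ : ∀ x, ⟪x - 0, curl U₂ x⟫ = 0)
    (hx₁ : x₁ ∉ tsupport U₂) (hx₂ : x₂ ∉ tsupport U₂) (hx₃ : x₃ ∉ tsupport U₁)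
    (hspan : ∀ a : EuclideanSpace ℝ (Fin 3),
      ⟪curl U₁ x₁, a⟫ = 0 → ⟪curl U₁ x₂, a⟫ = 0 → ⟪curl U₂ x₃, a⟫ = 0 → a = 0) :
    ∃ (U : EuclideanSpace ℝ (Fin 3) → EuclideanSpace ℝ (Fin 3)) (P : EuclideanSpace ℝ (Fin 3) → ℝ)
      (x₀ : EuclideanSpace ℝ (Fin 3)),
      (ContDiff ℝ 1 U ∧ ContDiff ℝ 1 P ∧ VectorCalculus.IsDivFree U ∧ ∀ x, convect U U x + gradient P x = 0) ∧
        HasCompactSupport U ∧ (∀ x, ⟪x - x₀, curl U x⟫ = 0) ∧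
          ¬ ∃ a : EuclideanSpace ℝ (Fin 3), a ≠ 0 ∧ ∀ x, ⟪curl U x, a⟫ = 0 := by
  refine ⟨U₁ + U₂, P₁ + P₂, 0, isSteadyEulerC1_add h₁ h₂ hdisj, hc₁.add hc₂,
    isUnthreadedAbout_add h₁.1 h₂.1 hu₁ hu₂, ?_⟩
  rintro ⟨a, ha, hperp⟩
  have e₁ : curl (U₁ + U₂) x₁ = curl U₁ x₁ := by
    rw [curl_eq_curlCLM, curl_eq_curlCLM, (add_eventuallyEq_left hx₁).fderiv_eq]
  have e₂ : curl (U₁ + U₂) x₂ = curl U₁ x₂ := by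
    rw [curl_eq_curlCLM, curl_eq_curlCLM, (add_eventuallyEq_left hx₂).fderiv_eq]
  have e₃ : curl (U₁ + U₂) x₃ = curl U₂ x₃ := by
    rw [curl_eq_curlCLM, curl_eq_curlCLM, (add_eventuallyEq_right hx₃).fderiv_eq]
  have ha₁ := hperp x₁; have ha₂ := hperp x₂; have ha₃ := hperp x₃
  rw [e₁] at ha₁; rw [e₂] at ha₂; rw [e₃] at ha₃
  exact ha (hspan a ha₁ ha₂ ha₃)

end Summit.NavierStokesRegularity.NavierStokesRegularity.Theorems.PoloidalLiouville.SilentShells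

end
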